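import Mathlib.SetTheory.Cardinal.ENat
import Literature.ModelTheory.Quasiminimal.PartialEmbeddings
import Literature.ModelTheory.Quasiminimal.PregeometryMatroid
import HarnessLib

/-!
# Countable quasiminimal pregeometry structures: closed embeddings and automorphisms (Kirby 2010 §2)

J. Kirby, *On quasiminimal excellent classes*, J. Symbolic Logic 75 (2010) 551–564, §2
("Uniqueness of models up to dimension `ℵ₁`"), proves for a class satisfying axioms I–II:

* **Theorem 2.1.** Let `dim H ≤ ℵ₁`, `G ⊆ H` empty or closed and countable, `f₀ : G → H'` a
  closed embedding, `B` a basis of `H` over `G` and `ψ_B` an injective map from `B` onto a set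
  independent over `im f₀`. Then `f₀ ∪ ψ_B` extends to a closed map `ψ̂ : H → H'`; if `im ψ`
  spans `H'` then `ψ̂` is an isomorphism.
* **Proposition 2.3.** For `G ⊆ H` empty or countable closed and `n`-tuples `x̄, ȳ` with the same
  quantifier-free type over `G` there is `σ ∈ Aut(H/G)` with `σ(x̄) = ȳ`.

Bays–Hart–Hyttinen–Kesälä–Kirby 2014 (*Quasiminimal structures and excellence*, Bull. LMS 46)
restate Prop. 2.3 as their Lemma 3.1 ("Galois types coincide with syntactic types for types over
the empty set and over models"), including the clause that an automorphism of a countable closed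
`M ◁ 𝔐` extends to one of `𝔐`.

This file proves these for a **countable** weakly quasiminimal pregeometry structure `M`
(`Literature.ModelTheory.Quasiminimal.IsWeaklyQuasiminimalPregeometryStructure`, BHHKK Def. 2.1
= Kirby's axioms I–II for the one-model class), with `H = H' = M`, which is the case used
throughout BHHKK §§4–6 ("Replacing `𝔐` with `cl(Mā)`, we may assume `𝔐` to be countable"):

* `IsWeaklyQuasiminimalPregeometryStructure.exists_isQFEmbOn_extend_indepFamily` — Thm 2.1:
  a partial embedding `f` on a closed `G` (or `G = ∅`) with closed image, together with a bijection
  `b i ↦ b' i` between a family independent over `G` and a family independent over `f[G]`,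
  extends to a partial embedding of `cl (G ∪ range b)` onto `cl (f[G] ∪ range b')`.
* `….exists_equiv_of_eqQFTypeOver` — Prop. 2.3 / BHHKK Lemma 3.1 (1) ⇒ (2): tuples with the same
  quantifier-free type over a closed-or-empty `G` are conjugate under an automorphism fixing `G`
  pointwise.
* `….exists_equiv_extend` — BHHKK Lemma 3.1 (3) ⇒ (4): an automorphism of a closed set `C`
  (a partial embedding on `C` with image `C`) extends to an automorphism of `M`.
* `IsQFEmbOn.relRank_image_eq` — partial embeddings preserve relative rank (dimension over a
  set), the dimension count behind Prop. 2.3 ("Extend `b̄` and `b̄'` to bases of `H` over `G`").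

Automorphisms are rendered as `σ : M ≃ M` with `IsQFEmbOn L σ univ`.

## References

* J. Kirby, *On quasiminimal excellent classes*, J. Symbolic Logic 75 (2010) 551–564,
  arXiv:0707.4496: Thm 2.1, Cor. 2.2, Prop. 2.3.
* M. Bays, B. Hart, T. Hyttinen, M. Kesälä, J. Kirby, *Quasiminimal structures and excellence*,
  Bull. London Math. Soc. 46 (2014) 155–163, arXiv:1210.2008: Lemma 3.1.
-/

noncomputable section

open Set FirstOrder FirstOrder.Language
open scoped Matroid

universe u v w

namespace Literature.ModelTheory.Quasiminimal

variable {L : Language.{u, v}} {M : Type w} [L.Structure M] {cl : Set M → Set M}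

/-! ### Small pregeometry facts -/

namespace IsPregeometry

/-- `cl (cl X ∪ Y) = cl (X ∪ Y)`. [folklore] -/
theorem cl_cl_union (h : IsPregeometry cl) (X Y : Set M) : cl (cl X ∪ Y) = cl (X ∪ Y) := by
  refine Subset.antisymm ?_ (h.mono (union_subset_union_left _ (h.subset_cl X)))
  have : cl X ∪ Y ⊆ cl (X ∪ Y) :=
    union_subset (h.mono subset_union_left) (subset_union_right.trans (h.subset_cl _))
  calc cl (cl X ∪ Y) ⊆ cl (cl (X ∪ Y)) := h.mono this
    _ = cl (X ∪ Y) := h.cl_cl _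

/-- `cl (X ∪ cl Y) = cl (X ∪ Y)`. [folklore] -/
theorem cl_union_cl (h : IsPregeometry cl) (X Y : Set M) : cl (X ∪ cl Y) = cl (X ∪ Y) := by
  rw [union_comm, h.cl_cl_union, union_comm]

/-- Finite character for closures of directed unions along `ℕ`: `cl (G ∪ ⋃ₙ Bₙ) = ⋃ₙ cl (G ∪ Bₙ)`
for a monotone sequence `B`. [folklore] -/
theorem cl_union_iUnion_eq (h : IsPregeometry cl) (G : Set M) {B : ℕ → Set M} (hB : Monotone B) :
    cl (G ∪ ⋃ n, B n) = ⋃ n, cl (G ∪ B n) := by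
  refine Subset.antisymm ?_ (iUnion_subset fun n => h.mono (union_subset_union_right _
    (subset_iUnion B n)))
  intro x hx
  obtain ⟨A₀, hA₀, hA₀fin, hxA₀⟩ := h.finite_character hx
  -- every element of `A₀ \ G` lies in some `B n`; take the maximum
  have : ∀ a : A₀, ∃ n, (a : M) ∈ G ∪ B n := fun a => by
    rcases hA₀ a.2 with ha | ha
    · exact ⟨0, Or.inl ha⟩
    · obtain ⟨n, hn⟩ := mem_iUnion.1 ha
      exact ⟨n, Or.inr hn⟩
  choose N hN using this
  haveI : Finite A₀ := hA₀fin.to_subtype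
  obtain ⟨m, hm⟩ : ∃ m, ∀ a : A₀, N a ≤ m := by
    obtain ⟨m, hm⟩ := Finite.exists_le N
    exact ⟨m, hm⟩
  refine mem_iUnion.2 ⟨m, h.mono ?_ hxA₀⟩
  intro a ha
  rcases hN ⟨a, ha⟩ with h1 | h1
  · exact Or.inl h1
  · exact Or.inr (hB (hm ⟨a, ha⟩) h1)

/-- Re-indexing a family independent over `G` along an equivalence. [folklore] -/
theorem _root_.Literature.ModelTheory.Quasiminimal.IndepFamilyOver.comp_equiv {G : Set M}
    {ι κ : Type*} {b : ι → M} (hb : IndepFamilyOver cl G b) (e : κ ≃ ι) :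
    IndepFamilyOver cl G (b ∘ e) := by
  intro k hk
  refine hb (e k) ?_
  have : (b ∘ e) '' {j | j ≠ k} = b '' {j | j ≠ e k} := by
    ext x
    simp only [mem_image, mem_setOf_eq, Function.comp_apply]
    constructor
    · rintro ⟨j, hj, rfl⟩
      exact ⟨e j, fun h => hj (e.injective h), rfl⟩
    · rintro ⟨j, hj, rfl⟩
      exact ⟨e.symm j, fun h => hj (by rw [← h, e.apply_symm_apply]), by simp⟩
  rwa [this] at hk

/-- A family independent over `G` stays independent over any `G' ⊆ cl G`... more usefully: over
any `G'` with `cl G' = cl G`. [folklore] -/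
theorem _root_.Literature.ModelTheory.Quasiminimal.IndepFamilyOver.of_cl_eq (h : IsPregeometry cl)
    {G G' : Set M} {ι : Type*} {b : ι → M} (hb : IndepFamilyOver cl G b) (hGG' : cl G' = cl G) :
    IndepFamilyOver cl G' b := by
  intro i hi
  refine hb i ?_
  rw [← h.cl_cl_union, ← hGG', h.cl_cl_union]
  exact hi

end IsPregeometry

/-! ### Partial embeddings preserve dimension over a set -/

/-- **Partial embeddings preserve relative rank.** If `f` is a partial embedding on `A` (in a
weakly quasiminimal pregeometry structure) and `G, X ⊆ A`, then the relative rank of `f '' X`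
over `f '' G` equals that of `X` over `G` (partial embeddings and their inverses preserve the
closure, hence independence over a set). This is the dimension count in the proof of Kirby 2010,
Prop. 2.3. [cite: Kirby2010QMEC, Prop. 2.3 (proof)] -/
theorem IsQFEmbOn.relRank_image_le (hW : IsWeaklyQuasiminimalPregeometryStructure L M cl)
    {f : M → M} {A : Set M} (hf : IsQFEmbOn L f A) {G X : Set M} (hG : G ⊆ A) (hX : X ⊆ A) :
    hW.isPregeometry.matroid.relRank G X ≤
      hW.isPregeometry.matroid.relRank (f '' G) (f '' X) := by
  have hP := hW.isPregeometry
  obtain ⟨I, hI⟩ := (hP.matroid ／ G).exists_isBasis' X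
  rw [Matroid.relRank_eq_eRk_contract, Matroid.relRank_eq_eRk_contract, ← hI.encard_eq_eRk]
  have hIX : I ⊆ X := hI.subset
  have hIA : I ⊆ A := hIX.trans hX
  -- `f '' I` is independent over `f '' G`
  have hind : (hP.matroid ／ (f '' G)).Indep (f '' I) := by
    have hI' := (hP.contract_indep_iff).1 hI.indep
    rw [hP.contract_indep_iff]
    refine ⟨disjoint_left.2 ?_, ?_⟩
    · rintro _ ⟨e, heI, rfl⟩ ⟨a, haG, hae⟩
      have : a = e := hf.injOn (hG haG) (hIA heI) hae
      exact disjoint_left.1 hI'.1 heI (this ▸ haG)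
    · rintro _ ⟨e, heI, rfl⟩ hecl
      apply hI'.2 heI
      -- pull back along the inverse of `f` on `A`
      haveI : Nonempty M := ⟨e⟩
      set g := Function.invFunOn f A with hg
      have hgf : ∀ a ∈ A, g (f a) = a := fun a ha => hf.injOn.leftInvOn_invFunOn ha
      have hginv : IsQFEmbOn L g (f '' A) := hf.inverse hgf
      have hsub : f '' G ∪ (f '' I \ {f e}) ⊆ f '' (G ∪ (I \ {e})) := by
        rintro y (⟨a, ha, rfl⟩ | ⟨⟨a, ha, rfl⟩, hne⟩)
        · exact ⟨a, Or.inl ha, rfl⟩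
        · exact ⟨a, Or.inr ⟨ha, fun hae => hne (by rw [mem_singleton_iff.1 hae]; exact mem_singleton _)⟩,
            rfl⟩
      have h1 : f e ∈ cl (f '' (G ∪ (I \ {e}))) := hP.mono hsub hecl
      have h2 := hginv.mem_cl_image hW (image_mono (union_subset hG (sdiff_subset.trans hIA)))
        (mem_image_of_mem f (hIA heI)) h1
      rw [hgf e (hIA heI), ← image_comp] at h2
      refine hP.mono ?_ h2
      rintro _ ⟨a, ha, rfl⟩
      rw [Function.comp_apply, hgf a (union_subset hG (sdiff_subset.trans hIA) ha)]
      exact ha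
  calc I.encard = (f '' I).encard := (hf.injOn.mono hIA).encard_image.symm
    _ ≤ (hP.matroid ／ (f '' G)).eRk (f '' X) := hind.encard_le_eRk_of_subset (image_mono hIX)

/-- **Partial embeddings preserve relative rank** (equality): for `f` a partial embedding on `A`
and `G, X ⊆ A`, `relRank (f '' G) (f '' X) = relRank G X`. [cite: Kirby2010QMEC, Prop. 2.3 (proof)] -/
theorem IsQFEmbOn.relRank_image_eq (hW : IsWeaklyQuasiminimalPregeometryStructure L M cl)
    {f : M → M} {A : Set M} (hf : IsQFEmbOn L f A) {G X : Set M} (hG : G ⊆ A) (hX : X ⊆ A) :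
    hW.isPregeometry.matroid.relRank (f '' G) (f '' X) =
      hW.isPregeometry.matroid.relRank G X := by
  refine le_antisymm ?_ (hf.relRank_image_le hW hG hX)
  rcases isEmpty_or_nonempty M with hM | hM
  · simp only [eq_empty_of_isEmpty G, eq_empty_of_isEmpty X, image_empty, le_refl]
  set g := Function.invFunOn f A with hg
  have hgf : LeftInvOn g f A := hf.injOn.leftInvOn_invFunOn
  have hginv : IsQFEmbOn L g (f '' A) := hf.inverse hgf
  have key := hginv.relRank_image_le hW (image_mono hG) (image_mono hX)
  rwa [(hgf.mono hG).image_image, (hgf.mono hX).image_image] at key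

/-! ### Sets of equal extended cardinality -/

omit [L.Structure M] in
/-- Countable sets with the same `encard` are in bijection. [folklore] -/
theorem nonempty_equiv_of_encard_eq [Countable M] {s t : Set M} (h : s.encard = t.encard) :
    Nonempty (s ≃ t) := by
  have hs : Cardinal.mk s ≤ Cardinal.aleph0 := Cardinal.mk_le_aleph0
  have ht : Cardinal.mk t ≤ Cardinal.aleph0 := Cardinal.mk_le_aleph0
  have : Cardinal.toENat (Cardinal.mk s) = Cardinal.toENat (Cardinal.mk t) := h
  exact Cardinal.eq.1 (Cardinal.toENat_injOn hs ht this)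

/-! ### Theorem 2.1 and Proposition 2.3 of Kirby 2010, countable case -/

namespace IsWeaklyQuasiminimalPregeometryStructure

omit [L.Structure M] in
/-- The range of the one-element tuple `Fin.snoc Fin.elim0 a`. [folklore] -/
theorem range_snoc_elim0 (a : M) :
    range (Fin.snoc (Fin.elim0 : Fin 0 → M) a : Fin 1 → M) = {a} := by
  rw [Fin.range_snoc, range_eq_empty, insert_empty_eq]

omit [L.Structure M] in
/-- The value of the one-element tuple `Fin.snoc Fin.elim0 a`. [folklore] -/
theorem snoc_elim0_zero (a : M) : (Fin.snoc (Fin.elim0 : Fin 0 → M) a : Fin 1 → M) 0 = a := rfl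

/-- **Kirby 2010, Theorem 2.1 (countable case): closed embeddings along independent families.**
Let `M` be a countable weakly quasiminimal pregeometry structure, `G ⊆ M` closed with `f` a
partial embedding on `G` whose image is closed (or `G = ∅`), and let `b`, `b'` be families
(same index type) independent over `G`, resp. over `f[G]`. Then `f ∪ (b i ↦ b' i)` extends to a
partial embedding `F` of `cl (G ∪ range b)` whose image is `cl (f[G] ∪ range b')` — a closed
embedding; "in particular, if `im ψ` spans `H'` then `ψ̂` is an isomorphism". The proof is
Kirby's: well-order `b`, and at successor stages match the new independent point by uniqueness of
the generic type (axiom II.1 / QM4, `eqQFTypeOver_snoc_of_notMem_cl`) and run a back-and-forth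
through the countable closures by `ℵ₀`-homogeneity over the closed set built so far (axiom II.2
/ QM5, `exists_isQFEmbOn_cl_extend`); take unions at the limit.
[cite: Kirby2010QMEC, Thm 2.1] -/
theorem exists_isQFEmbOn_extend_indepFamily [Countable M]
    (hW : IsWeaklyQuasiminimalPregeometryStructure L M cl) {G : Set M} {f : M → M}
    (hG : (cl G = G ∧ cl (f '' G) = f '' G) ∨ G = ∅) (hf : IsQFEmbOn L f G)
    {ι : Type*} {b b' : ι → M} (hb : IndepFamilyOver cl G b)
    (hb' : IndepFamilyOver cl (f '' G) b') :
    ∃ F : M → M, IsQFEmbOn L F (cl (G ∪ range b)) ∧ EqOn F f G ∧ (∀ i, F (b i) = b' i) ∧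
      F '' cl (G ∪ range b) = cl (f '' G ∪ range b') := by
  classical
  have hP := hW.isPregeometry
  -- enumerate the index type
  haveI : Countable ι := (hb.injective hP).countable
  obtain ⟨enc, henc⟩ := exists_injective_nat ι
  let B : ℕ → Set M := fun n => b '' {i | enc i < n}
  let B' : ℕ → Set M := fun n => b' '' {i | enc i < n}
  let Gn : ℕ → Set M := fun n => cl (G ∪ B n)
  have hBmono : Monotone B := fun n m hnm => image_mono fun i (hi : enc i < n) => lt_of_lt_of_le hi hnm
  have hB'mono : Monotone B' := fun n m hnm => image_mono fun i (hi : enc i < n) => lt_of_lt_of_le hi hnm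
  have hGmono : Monotone Gn := fun n m hnm => hP.mono (union_subset_union_right _ (hBmono hnm))
  have hB0 : B 0 = ∅ := by
    simp only [B, Nat.not_lt_zero, setOf_false, image_empty]
  have hB'0 : B' 0 = ∅ := by
    simp only [B', Nat.not_lt_zero, setOf_false, image_empty]
  have hGncl : ∀ n, cl (Gn n) = Gn n := fun n => hP.cl_cl _
  -- the stage invariant
  let P : ℕ → (M → M) → Prop := fun n F =>
    IsQFEmbOn L F (Gn n) ∧ EqOn F f G ∧ (∀ i, enc i < n → F (b i) = b' i) ∧
      F '' Gn n = cl (f '' G ∪ B' n)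
  -- stage 0
  have hP0 : ∃ F, P 0 F := by
    rcases hG with ⟨hGcl, hfGcl⟩ | hGe
    · refine ⟨f, ?_, fun a _ => rfl, fun i hi => absurd hi (Nat.not_lt_zero _), ?_⟩
      · change IsQFEmbOn L f (cl (G ∪ B 0))
        rwa [hB0, union_empty, hGcl]
      · change f '' cl (G ∪ B 0) = cl (f '' G ∪ B' 0)
        rw [hB0, hB'0, union_empty, union_empty, hGcl, hfGcl]
    · have h00 : L.EqQFTypeOver (∅ : Set M) f (Fin.elim0 : Fin 0 → M) Fin.elim0 :=
        eqQFTypeOver_empty_iff.2 (EqQFType.refl _)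
      obtain ⟨F, hF, -, -, hFim⟩ := hW.exists_isQFEmbOn_cl_extend countable_empty (Or.inr rfl) h00
      subst hGe
      refine ⟨F, ?_, fun a ha => absurd ha (notMem_empty a), fun i hi => absurd hi (Nat.not_lt_zero _), ?_⟩
      · change IsQFEmbOn L F (cl (∅ ∪ B 0))
        rw [hB0]
        rwa [range_eq_empty] at hF
      · change F '' cl (∅ ∪ B 0) = cl (f '' ∅ ∪ B' 0)
        rw [hB0, hB'0]
        rw [range_eq_empty] at hFim
        exact hFim
  -- successor stages
  have hstep : ∀ n F, P n F → ∃ F', P (n + 1) F' ∧ EqOn F' F (Gn n) := by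
    rintro n F ⟨hF, hFf, hFb, hFim⟩
    by_cases hex : ∃ i, enc i = n
    · obtain ⟨i₀, hi₀⟩ := hex
      have hBsucc : B (n + 1) = B n ∪ {b i₀} := by
        ext x
        simp only [B, mem_image, mem_setOf_eq, mem_union, mem_singleton_iff]
        constructor
        · rintro ⟨i, hi, rfl⟩
          rcases Nat.lt_succ_iff_lt_or_eq.1 hi with hi | hi
          · exact Or.inl ⟨i, hi, rfl⟩
          · exact Or.inr (by rw [henc (hi.trans hi₀.symm)])
        · rintro (⟨i, hi, rfl⟩ | rfl)
          · exact ⟨i, Nat.lt_succ_of_lt hi, rfl⟩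
          · exact ⟨i₀, by omega, rfl⟩
      have hB'succ : B' (n + 1) = B' n ∪ {b' i₀} := by
        ext x
        simp only [B', mem_image, mem_setOf_eq, mem_union, mem_singleton_iff]
        constructor
        · rintro ⟨i, hi, rfl⟩
          rcases Nat.lt_succ_iff_lt_or_eq.1 hi with hi | hi
          · exact Or.inl ⟨i, hi, rfl⟩
          · exact Or.inr (by rw [henc (hi.trans hi₀.symm)])
        · rintro (⟨i, hi, rfl⟩ | rfl)
          · exact ⟨i, Nat.lt_succ_of_lt hi, rfl⟩
          · exact ⟨i₀, by omega, rfl⟩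
      have hGhyp : (cl (Gn n) = Gn n ∧ cl (F '' Gn n) = F '' Gn n) ∨ Gn n = ∅ :=
        Or.inl ⟨hGncl n, by rw [hFim]; exact hP.cl_cl _⟩
      have hnot : b i₀ ∉ cl (Gn n ∪ range (Fin.elim0 : Fin 0 → M)) := by
        rw [range_eq_empty, union_empty, hGncl n]
        intro hmem
        refine hb i₀ (hP.mono (union_subset_union_right _ ?_) hmem)
        rintro _ ⟨j, hj, rfl⟩
        exact ⟨j, fun hji => absurd hi₀ (by rw [← hji]; exact Nat.ne_of_lt hj), rfl⟩
      have hnot' : b' i₀ ∉ cl (F '' Gn n ∪ range (Fin.elim0 : Fin 0 → M)) := by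
        rw [range_eq_empty, union_empty, hFim, hP.cl_cl]
        intro hmem
        refine hb' i₀ (hP.mono (union_subset_union_right _ ?_) hmem)
        rintro _ ⟨j, hj, rfl⟩
        exact ⟨j, fun hji => absurd hi₀ (by rw [← hji]; exact Nat.ne_of_lt hj), rfl⟩
      have h1pt := hW.eqQFTypeOver_snoc_of_notMem_cl (to_countable _) hGhyp hF.eqQFTypeOver_elim0
        hnot hnot'
      obtain ⟨F', hF', hF'F, hF't, hF'im⟩ := hW.exists_isQFEmbOn_cl_extend (to_countable _) hGhyp h1pt
      have hdom : cl (Gn n ∪ range (Fin.snoc (Fin.elim0 : Fin 0 → M) (b i₀) : Fin 1 → M)) =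
          Gn (n + 1) := by
        rw [range_snoc_elim0]
        change cl (cl (G ∪ B n) ∪ {b i₀}) = cl (G ∪ B (n + 1))
        rw [hP.cl_cl_union, hBsucc, union_assoc]
      have him : cl (F '' Gn n ∪ range (Fin.snoc (Fin.elim0 : Fin 0 → M) (b' i₀) : Fin 1 → M)) =
          cl (f '' G ∪ B' (n + 1)) := by
        rw [range_snoc_elim0, hFim, hP.cl_cl_union, hB'succ, union_assoc]
      rw [hdom] at hF'
      rw [hdom, him] at hF'im
      refine ⟨F', ⟨hF', ?_, ?_, hF'im⟩, hF'F⟩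
      · intro a ha
        rw [hF'F (subset_union_left.trans (hP.subset_cl _) ha), hFf ha]
      · intro i hi
        rcases Nat.lt_succ_iff_lt_or_eq.1 hi with hi | hi
        · have hbi : b i ∈ Gn n := hP.subset_cl _ (Or.inr ⟨i, hi, rfl⟩)
          rw [hF'F hbi, hFb i hi]
        · have : i = i₀ := henc (hi.trans hi₀.symm)
          subst this
          have := hF't 0
          rw [snoc_elim0_zero, snoc_elim0_zero] at this
          exact this
    · -- no new point at this stage
      have hBsucc : B (n + 1) = B n := by
        ext x
        simp only [B, mem_image, mem_setOf_eq]
        constructor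
        · rintro ⟨i, hi, rfl⟩
          rcases Nat.lt_succ_iff_lt_or_eq.1 hi with hi | hi
          · exact ⟨i, hi, rfl⟩
          · exact absurd ⟨i, hi⟩ hex
        · rintro ⟨i, hi, rfl⟩
          exact ⟨i, Nat.lt_succ_of_lt hi, rfl⟩
      have hB'succ : B' (n + 1) = B' n := by
        ext x
        simp only [B', mem_image, mem_setOf_eq]
        constructor
        · rintro ⟨i, hi, rfl⟩
          rcases Nat.lt_succ_iff_lt_or_eq.1 hi with hi | hi
          · exact ⟨i, hi, rfl⟩
          · exact absurd ⟨i, hi⟩ hex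
        · rintro ⟨i, hi, rfl⟩
          exact ⟨i, Nat.lt_succ_of_lt hi, rfl⟩
      have hGsucc : Gn (n + 1) = Gn n := by
        change cl (G ∪ B (n + 1)) = cl (G ∪ B n)
        rw [hBsucc]
      refine ⟨F, ⟨?_, hFf, ?_, ?_⟩, fun a _ => rfl⟩
      · rwa [hGsucc]
      · intro i hi
        rcases Nat.lt_succ_iff_lt_or_eq.1 hi with hi | hi
        · exact hFb i hi
        · exact absurd ⟨i, hi⟩ hex
      · rw [hGsucc, hB'succ, hFim]
  -- the sequence of stages
  choose! next hnext using hstep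
  obtain ⟨F₀, hF₀⟩ := hP0
  let seq : ℕ → (M → M) := fun n => Nat.rec F₀ (fun n F => next n F) n
  have hseq_succ : ∀ n, seq (n + 1) = next n (seq n) := fun n => rfl
  have hseq : ∀ n, P n (seq n) := by
    intro n
    induction n with
    | zero => exact hF₀
    | succ n ih => rw [hseq_succ]; exact (hnext n _ ih).1
  have hcoh : ∀ {n m}, n ≤ m → EqOn (seq m) (seq n) (Gn n) := by
    intro n m hnm
    induction hnm with
    | refl => exact fun a _ => rfl
    | step hle ih =>
      intro a ha
      rw [hseq_succ, (hnext _ _ (hseq _)).2 (hGmono hle ha), ih ha]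
  -- the limit map
  let Fω : M → M := fun x => if hx : ∃ n, x ∈ Gn n then seq (Nat.find hx) x else x
  have hFω : ∀ n, EqOn Fω (seq n) (Gn n) := by
    intro n x hx
    have hex : ∃ n, x ∈ Gn n := ⟨n, hx⟩
    simp only [Fω, dif_pos hex]
    exact (hcoh (Nat.find_min' hex hx) (Nat.find_spec hex)).symm
  have hdom : cl (G ∪ range b) = ⋃ n, Gn n := by
    have hrange : range b = ⋃ n, B n := by
      ext x
      simp only [mem_range, mem_iUnion, B, mem_image, mem_setOf_eq]
      constructor
      · rintro ⟨i, rfl⟩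
        exact ⟨enc i + 1, i, Nat.lt_succ_self _, rfl⟩
      · rintro ⟨n, i, -, rfl⟩
        exact ⟨i, rfl⟩
    rw [hrange]
    exact hP.cl_union_iUnion_eq G hBmono
  have him : cl (f '' G ∪ range b') = ⋃ n, cl (f '' G ∪ B' n) := by
    have hrange : range b' = ⋃ n, B' n := by
      ext x
      simp only [mem_range, mem_iUnion, B', mem_image, mem_setOf_eq]
      constructor
      · rintro ⟨i, rfl⟩
        exact ⟨enc i + 1, i, Nat.lt_succ_self _, rfl⟩
      · rintro ⟨n, i, -, rfl⟩
        exact ⟨i, rfl⟩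
    rw [hrange]
    exact hP.cl_union_iUnion_eq _ hB'mono
  refine ⟨Fω, ?_, ?_, ?_, ?_⟩
  · rw [hdom]
    exact IsQFEmbOn.iUnion_nat hGmono fun n => ((hseq n).1).congr (hFω n).symm
  · intro a ha
    have ha0 : a ∈ Gn 0 := hP.subset_cl _ (Or.inl ha)
    rw [hFω 0 ha0, (hseq 0).2.1 ha]
  · intro i
    have hbi : b i ∈ Gn (enc i + 1) := hP.subset_cl _ (Or.inr ⟨i, Nat.lt_succ_self _, rfl⟩)
    rw [hFω _ hbi, (hseq _).2.2.1 i (Nat.lt_succ_self _)]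
  · rw [hdom, him, image_iUnion]
    refine iUnion_congr fun n => ?_
    rw [← (hseq n).2.2.2]
    exact image_congr fun a ha => hFω n ha

/-- **Bases of a closed set over a subset.** For `G ⊆ C` with `C` closed there is `B ⊆ C`,
independent over `G`, with `cl (G ∪ B) = C` and `#B = relRank G C` (a basis of `C` in the
contraction `matroid ／ G`; Kirby 2010 §2, "a basis of `H` over `G`"). [folklore] -/
theorem _root_.Literature.ModelTheory.Quasiminimal.IsPregeometry.exists_indepFamilyOver_within
    (h : IsPregeometry cl) {G C : Set M} (hGC : G ⊆ C) (hC : cl C = C) :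
    ∃ B : Set M, B ⊆ C ∧ IndepFamilyOver cl G ((↑) : B → M) ∧ cl (G ∪ B) = C ∧
      B.encard = h.matroid.relRank G C := by
  obtain ⟨I, hI⟩ := (h.matroid ／ G).exists_isBasis' C
  have hIC : I ⊆ C := hI.subset
  refine ⟨I, hIC, h.indepFamilyOver_of_contract_indep Subtype.coe_injective
    (by rw [Subtype.range_coe]; exact hI.indep), ?_, ?_⟩
  · refine Subset.antisymm ?_ ?_
    · calc cl (G ∪ I) ⊆ cl C := h.mono (union_subset hGC hIC)
        _ = C := hC
    · intro x hx
      by_cases hxG : x ∈ G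
      · exact h.subset_cl _ (Or.inl hxG)
      · have hB := hI.isBasis_inter_ground
        have hx' : x ∈ C ∩ (h.matroid ／ G).E := ⟨hx, by simp [hxG]⟩
        have := hB.subset_closure hx'
        rw [Matroid.contract_closure_eq, h.matroid_closure] at this
        rw [union_comm]
        exact this.1
  · rw [Matroid.relRank_eq_eRk_contract, hI.encard_eq_eRk]

/-- **Kirby 2010, Prop. 2.3 inside a closed set.** Let `M` be a countable weakly quasiminimal
pregeometry structure, `C ⊆ M` closed, `G ⊆ C` closed or empty, and `x̄`, `ȳ` tuples from `C`
with the same quantifier-free type over `G`. Then there is an automorphism of `C` over `G`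
carrying `x̄` to `ȳ`: a partial embedding `τ` on `C` with `τ '' C = C`, fixing `G` pointwise, with
`τ(x̄) = ȳ`. This is Prop. 2.3 for the closed substructure `C` (BHHKK 2014, Lemma 3.1,
(1) ⇒ (2), for the countable closed `M ◁ 𝔐`). Proof: extend `id_G ∪ (x̄ ↦ ȳ)` through the
closures (`exists_isQFEmbOn_cl_extend`), compare the dimensions of `C` over `cl (G x̄)` and
over `cl (G ȳ)` (partial embeddings preserve relative rank, and the addition formula), choose
bases of `C` over them of the same size and apply Theorem 2.1.
[cite: Kirby2010QMEC, Prop. 2.3] [cite: BHHKK2014, Lemma 3.1] -/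
theorem exists_isQFEmbOn_of_eqQFTypeOver_within [Countable M]
    (hW : IsWeaklyQuasiminimalPregeometryStructure L M cl) {C : Set M} (hC : cl C = C)
    {G : Set M} (hGC : G ⊆ C) (hG : cl G = G ∨ G = ∅) {n : ℕ} {x y : Fin n → M}
    (hx : ∀ i, x i ∈ C) (hy : ∀ i, y i ∈ C) (hxy : L.EqQFTypeOver G id x y) :
    ∃ τ : M → M, IsQFEmbOn L τ C ∧ τ '' C = C ∧ (∀ a ∈ G, τ a = a) ∧ ∀ i, τ (x i) = y i := by
  classical
  have hP := hW.isPregeometry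
  have hG' : (cl G = G ∧ cl (id '' G) = id '' G) ∨ G = ∅ := by
    rcases hG with h | h
    · exact Or.inl ⟨h, by rwa [image_id]⟩
    · exact Or.inr h
  obtain ⟨F₀, hF₀, hF₀id, hF₀x, hF₀im⟩ := hW.exists_isQFEmbOn_cl_extend (to_countable _) hG' hxy
  rw [image_id] at hF₀im
  set H₀ := cl (G ∪ range x) with hH₀
  set H₀' := cl (G ∪ range y) with hH₀'
  have hH₀cl : cl H₀ = H₀ := hP.cl_cl _
  have hH₀'cl : cl H₀' = H₀' := hP.cl_cl _
  have hGH₀ : G ⊆ H₀ := subset_union_left.trans (hP.subset_cl _)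
  have hGH₀' : G ⊆ H₀' := subset_union_left.trans (hP.subset_cl _)
  have hxH₀ : range x ⊆ H₀ := subset_union_right.trans (hP.subset_cl _)
  have hH₀C : H₀ ⊆ C := by
    rw [← hC]; exact hP.mono (union_subset hGC (range_subset_iff.2 hx))
  have hH₀'C : H₀' ⊆ C := by
    rw [← hC]; exact hP.mono (union_subset hGC (range_subset_iff.2 hy))
  -- dimensions of `C` over `H₀` and over `H₀'` agree
  have hrk : hP.matroid.relRank H₀ C = hP.matroid.relRank H₀' C := by
    have h1 := hP.matroid.relRank_add_relRank hGH₀ hH₀C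
    have h2 := hP.matroid.relRank_add_relRank hGH₀' hH₀'C
    have e1 : hP.matroid.relRank G H₀ = hP.matroid.relRank G (range x) := by
      refine hP.matroid.relRank_congr_closure G ?_
      rw [hP.matroid_closure, hP.matroid_closure, union_comm (range x) G, hH₀, hP.cl_cl_union,
        union_eq_self_of_subset_right subset_union_left]
    have e2 : hP.matroid.relRank G H₀' = hP.matroid.relRank G (range y) := by
      refine hP.matroid.relRank_congr_closure G ?_
      rw [hP.matroid_closure, hP.matroid_closure, union_comm (range y) G, hH₀', hP.cl_cl_union,
        union_eq_self_of_subset_right subset_union_left]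
    have hfin : hP.matroid.relRank G H₀ ≠ ⊤ := by
      rw [e1]
      refine ne_top_of_le_ne_top ?_ (hP.matroid.relRank_le_encard_diff G (range x))
      exact ((finite_range x).subset sdiff_subset).encard_lt_top.ne
    have heq : hP.matroid.relRank G H₀ = hP.matroid.relRank G H₀' := by
      have e3 := hF₀.relRank_image_eq hW hGH₀ hxH₀
      have hFG : F₀ '' G = G := by
        rw [(image_congr fun a ha => hF₀id ha : F₀ '' G = id '' G), image_id]
      have hFx : F₀ '' range x = range y := by
        rw [← range_comp]
        exact congr_arg range (funext hF₀x)
      rw [hFG, hFx] at e3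
      rw [e1, e2, e3]
    rw [heq] at h1
    rw [← h2] at h1
    exact WithTop.add_left_cancel (by rwa [← heq]) h1
  -- bases of `C` over `H₀`, `H₀'` of the same size
  obtain ⟨B₁, -, hB₁, hB₁sp, hB₁card⟩ := hP.exists_indepFamilyOver_within hH₀C hC
  obtain ⟨B₂, -, hB₂, hB₂sp, hB₂card⟩ := hP.exists_indepFamilyOver_within hH₀'C hC
  have hcard : B₁.encard = B₂.encard := by rw [hB₁card, hB₂card, hrk]
  obtain ⟨e⟩ := nonempty_equiv_of_encard_eq hcard
  have hb₂ : IndepFamilyOver cl (F₀ '' H₀) (((↑) : B₂ → M) ∘ e) := by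
    rw [hF₀im]
    exact hB₂.comp_equiv e
  have hGhyp : (cl H₀ = H₀ ∧ cl (F₀ '' H₀) = F₀ '' H₀) ∨ H₀ = ∅ :=
    Or.inl ⟨hH₀cl, by rw [hF₀im]; exact hH₀'cl⟩
  obtain ⟨F, hF, hFF₀, hFb, hFim⟩ := hW.exists_isQFEmbOn_extend_indepFamily hGhyp hF₀ hB₁ hb₂
  have hdomC : cl (H₀ ∪ range ((↑) : B₁ → M)) = C := by rwa [Subtype.range_coe]
  have himC : cl (F₀ '' H₀ ∪ range (((↑) : B₂ → M) ∘ e)) = C := by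
    rw [hF₀im, range_comp, e.surjective.range_eq, image_univ, Subtype.range_coe]
    exact hB₂sp
  rw [hdomC] at hF
  rw [hdomC, himC] at hFim
  refine ⟨F, hF, hFim, fun a ha => ?_, fun i => ?_⟩
  · rw [hFF₀ (hGH₀ ha), hF₀id ha]
    rfl
  · rw [hFF₀ (hxH₀ (mem_range_self i)), hF₀x i]

/-- **BHHKK 2014, Lemma 3.1 ((3) ⇒ (4)): automorphisms of countable closed subsets extend.** In a
countable weakly quasiminimal pregeometry structure, a partial embedding `τ` on a closed set `C`
with `τ '' C = C` extends to an automorphism of `M`. (Kirby 2010, Thm 2.1 with `G = C`,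
`f₀ = τ`, and `ψ_B` the identity on a basis of `M` over `C`.)
[cite: BHHKK2014, Lemma 3.1] [cite: Kirby2010QMEC, Thm 2.1] -/
theorem exists_equiv_extend [Countable M]
    (hW : IsWeaklyQuasiminimalPregeometryStructure L M cl) {C : Set M} (hC : cl C = C)
    {τ : M → M} (hτ : IsQFEmbOn L τ C) (hτC : τ '' C = C) :
    ∃ σ : M ≃ M, IsQFEmbOn L σ univ ∧ ∀ a ∈ C, σ a = τ a := by
  have hP := hW.isPregeometry
  obtain ⟨B, hB, hBsp, -⟩ := hP.exists_indepFamilyOver C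
  have hGhyp : (cl C = C ∧ cl (τ '' C) = τ '' C) ∨ C = ∅ := Or.inl ⟨hC, by rwa [hτC]⟩
  have hB' : IndepFamilyOver cl (τ '' C) ((↑) : B → M) := by rwa [hτC]
  obtain ⟨F, hF, hFτ, -, hFim⟩ := hW.exists_isQFEmbOn_extend_indepFamily hGhyp hτ hB hB'
  rw [Subtype.range_coe, hBsp] at hF
  rw [hτC, Subtype.range_coe, hBsp, image_univ] at hFim
  have hbij : Function.Bijective F :=
    ⟨fun a b hab => hF.injOn (mem_univ a) (mem_univ b) hab, fun b => by
      have : b ∈ range F := hFim.symm ▸ mem_univ b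
      exact this⟩
  exact ⟨Equiv.ofBijective F hbij, hF, fun a ha => hFτ ha⟩

/-- **BHHKK 2014, Lemma 3.1 ((1) ⇒ (4)).** With `C`, `G`, `x̄`, `ȳ` as in
`exists_isQFEmbOn_of_eqQFTypeOver_within`, there is an automorphism `σ` of the whole of `M`
fixing `G` pointwise, preserving `C` setwise and carrying `x̄` to `ȳ` ("there exists
`f ∈ Aut(𝔐/H)` with `f(ā) = b̄` and `f(M) = M`"). [cite: BHHKK2014, Lemma 3.1] -/
theorem exists_equiv_of_eqQFTypeOver_within [Countable M]
    (hW : IsWeaklyQuasiminimalPregeometryStructure L M cl) {C : Set M} (hC : cl C = C)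
    {G : Set M} (hGC : G ⊆ C) (hG : cl G = G ∨ G = ∅) {n : ℕ} {x y : Fin n → M}
    (hx : ∀ i, x i ∈ C) (hy : ∀ i, y i ∈ C) (hxy : L.EqQFTypeOver G id x y) :
    ∃ σ : M ≃ M, IsQFEmbOn L σ univ ∧ σ '' C = C ∧ (∀ a ∈ G, σ a = a) ∧ ∀ i, σ (x i) = y i := by
  obtain ⟨τ, hτ, hτC, hτG, hτx⟩ := hW.exists_isQFEmbOn_of_eqQFTypeOver_within hC hGC hG hx hy hxy
  obtain ⟨σ, hσ, hστ⟩ := hW.exists_equiv_extend hC hτ hτC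
  refine ⟨σ, hσ, ?_, fun a ha => (hστ a (hGC ha)).trans (hτG a ha),
    fun i => (hστ _ (hx i)).trans (hτx i)⟩
  calc (σ : M → M) '' C = τ '' C := image_congr fun a ha => hστ a ha
    _ = C := hτC

/-- **Kirby 2010, Prop. 2.3 = BHHKK 2014, Lemma 3.1 ((1) ⇒ (2)): quantifier-free types over a
closed set are automorphism orbits.** In a countable weakly quasiminimal pregeometry structure,
tuples `x̄`, `ȳ` with the same quantifier-free type over a closed-or-empty `G` are conjugate by an
automorphism of `M` fixing `G` pointwise. [cite: Kirby2010QMEC, Prop. 2.3] [cite: BHHKK2014, Lemma 3.1] -/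
theorem exists_equiv_of_eqQFTypeOver [Countable M]
    (hW : IsWeaklyQuasiminimalPregeometryStructure L M cl) {G : Set M} (hG : cl G = G ∨ G = ∅)
    {n : ℕ} {x y : Fin n → M} (hxy : L.EqQFTypeOver G id x y) :
    ∃ σ : M ≃ M, IsQFEmbOn L σ univ ∧ (∀ a ∈ G, σ a = a) ∧ ∀ i, σ (x i) = y i := by
  have huniv : cl (univ : Set M) = univ := eq_univ_of_univ_subset (hW.isPregeometry.subset_cl _)
  obtain ⟨σ, hσ, -, hσG, hσx⟩ := hW.exists_equiv_of_eqQFTypeOver_within huniv (subset_univ G) hG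
    (fun i => mem_univ (x i)) (fun i => mem_univ (y i)) hxy
  exact ⟨σ, hσ, hσG, hσx⟩

/-- **Inverses of automorphisms.** If `σ : M ≃ M` is a partial embedding on `univ` then so is
`σ.symm`. [folklore] -/
theorem isQFEmbOn_symm {σ : M ≃ M} (hσ : IsQFEmbOn L σ univ) : IsQFEmbOn L σ.symm univ := by
  have := hσ.inverse (g := σ.symm) fun a _ => σ.symm_apply_apply a
  rwa [image_univ, σ.surjective.range_eq] at this

/-- **Automorphisms preserve the closure**: `σ '' cl X = cl (σ '' X)` for an automorphism `σ`.
[folklore] -/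
theorem equiv_image_cl (hW : IsWeaklyQuasiminimalPregeometryStructure L M cl) {σ : M ≃ M}
    (hσ : IsQFEmbOn L σ univ) (X : Set M) : σ '' cl X = cl (σ '' X) :=
  hσ.image_cl_eq hW (subset_univ _) (by
    rw [image_univ, σ.surjective.range_eq]; exact subset_univ _)

end IsWeaklyQuasiminimalPregeometryStructure

end Literature.ModelTheory.Quasiminimal

end
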